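import Summits.Langlands.Langlands.Theorems.SoloBlindLocalAgreementFull
import HarnessLib

/-!
# Given reciprocity for one datum, reciprocity for another datum is equivalent to local agreement

A corollary of `SoloBlindReciprocityTransfer` (transfer along local agreement) and
`SoloBlindLocalAgreementFull` (reciprocity for two data forces local agreement): for fixed `n ≥ 1`,
`K`, `hcpt` and a pinned datum `𝓡` satisfying `GlobalLanglandsCorrespondenceGLn n K 𝓡 hcpt`, a second
pinned datum `𝓡'` satisfies it iff `𝓡` and `𝓡'` give the same class to every local component of every
L-algebraic cuspidal `π` of `GL_n(𝔸_K)`.  So, per `(n, K, hcpt)`, the set of data for which reciprocity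
holds is empty or exactly one local-agreement class; the summit asserts it is everything.

## References

* G. Henniart, Invent. Math. 113 (1993). [Henniart1993]
* K. Buzzard, T. Gee, LMS Lecture Notes 414 (2014), Conj. 3.2.1–3.2.2. [BuzzardGeeLMS2014]
-/

open scoped MatrixGroups Matrix Classical NumberField
open NumberField IsDedekindDomain Filter Field
open Literature.NumberTheory.Automorphic Literature.NumberTheory.GaloisRepresentations

noncomputable section

namespace Summit.Langlands.Langlands.Theorems

namespace SoloBlind

variable {K : Type} [Field K] [NumberField K] {n : ℕ}

/-- **Direction (A) for two data already forces local agreement** (the proof of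
`recGL_eq_of_globalLanglands` uses only the (A)-components): if (A) holds for `𝓡` and for `𝓡'` then
`rec_𝓡(π_v) = rec_𝓡'(π_v)` for every local component of every L-algebraic cuspidal `π`.
[cite: BuzzardGeeLMS2014, Conj. 3.2.1] [cite: Henniart1993, Thm. 1.1] -/
theorem recGL_eq_of_automorphicToGalois {𝓡 𝓡' : ReciprocityData K}
    {hcpt : isCompact_glFiniteIntegralLevel n K}
    (hA : AutomorphicToGalois n 𝓡 hcpt) (hA' : AutomorphicToGalois n 𝓡' hcpt)
    (π : CuspidalAutomorphicRepData n K hcpt) (hπ : π.1.IsLAlgebraic) (v : HeightOneSpectrum (𝓞 K))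
    (πv : SmoothIrrep (GL (Fin n) (v.adicCompletion K))) (hπv : π.1.HasLocalComponentAt v πv.ρ) :
    (𝓡.llc v).recGL n (IrrClass.mk πv) = (𝓡'.llc v).recGL n (IrrClass.mk πv) := by
  obtain ⟨ℓ, hℓ, hℓv⟩ := exists_prime_natCast_not_mem v
  haveI : Fact ℓ.Prime := ⟨hℓ⟩
  obtain ⟨ι⟩ := PadicAlgCl.nonempty_ringEquiv_complex ℓ
  obtain ⟨ρ, hirr, -, hcorr, -⟩ := hA π hπ ℓ ι
  obtain ⟨ρ', -, -, hcorr', -⟩ := hA' π hπ ℓ ι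
  obtain ⟨g, hg⟩ :=
    isConjugate_of_eventually ρ ρ' hirr (eventually_frobCharpoly_of_corresponds₂ hcorr hcorr')
  obtain ⟨πv₁, r, rℂ, hlc, hWD, -, htr, hcl⟩ := hcorr.2 v
  obtain ⟨πv₂, r', rℂ', hlc', hWD', -, htr', hcl'⟩ := hcorr'.2 v
  have hρ'W : FramedRep.toWeilGroupHom (FramedGaloisRep.toLocal v ρ') =
      (MulAut.conj g).toMonoidHom.comp (ρ.toLocal v).toWeilGroupHom := by
    rw [← hg]
    exact toWeilGroupHom_toLocal_conj g ρ v
  have e₁ : r.IsEquivalent r' :=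
    wd_isEquivalent_of_isWeilDeligneOfLadic_conj _ g r r' (hWD hℓv) (hρ'W ▸ hWD' hℓv)
  have e₂ : rℂ.IsEquivalent rℂ' := wd_isEquivalent_of_isTransportAlong (ι : _ →+* ℂ) e₁ htr htr'
  have e₃ := hasFrobSemisimpleClass_unique_of_isEquivalent e₂ hcl hcl'
  have u₁ : IrrClass.mk πv = IrrClass.mk πv₁ :=
    AutomorphicRepData.hasLocalComponentAt_unique_holds π.1 v πv πv₁ hπv hlc
  have u₂ : IrrClass.mk πv = IrrClass.mk πv₂ :=
    AutomorphicRepData.hasLocalComponentAt_unique_holds π.1 v πv πv₂ hπv hlc'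
  calc (𝓡.llc v).recGL n (IrrClass.mk πv) = (𝓡.llc v).recGL n (IrrClass.mk πv₁) := by rw [u₁]
    _ = (𝓡'.llc v).recGL n (IrrClass.mk πv₂) := e₃
    _ = (𝓡'.llc v).recGL n (IrrClass.mk πv) := by rw [← u₂]

/-- **Reciprocity classes of data.** If reciprocity for `GL_n` over `K` holds for the pinned datum `𝓡`,
then it holds for `𝓡'` iff `𝓡'` agrees with `𝓡` on the local components of the L-algebraic cuspidal
`π` of `GL_n(𝔸_K)`. [cite: BuzzardGeeLMS2014, Conj. 3.2.2] [cite: Henniart1993, Thm. 1.1] -/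
theorem globalLanglands_iff_recGL_eq {𝓡 𝓡' : ReciprocityData K} {hcpt : isCompact_glFiniteIntegralLevel n K}
    (h : GlobalLanglandsCorrespondenceGLn n K 𝓡 hcpt) :
    GlobalLanglandsCorrespondenceGLn n K 𝓡' hcpt ↔
      ∀ π : CuspidalAutomorphicRepData n K hcpt, π.1.IsLAlgebraic →
        ∀ (v : HeightOneSpectrum (𝓞 K)) (πv : SmoothIrrep (GL (Fin n) (v.adicCompletion K))),
          π.1.HasLocalComponentAt v πv.ρ →
            (𝓡.llc v).recGL n (IrrClass.mk πv) = (𝓡'.llc v).recGL n (IrrClass.mk πv) :=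
  ⟨fun h' π hπ v πv hπv ↦ recGL_eq_of_automorphicToGalois h.1 h'.1 π hπ v πv hπv,
    fun hagree ↦ globalLanglandsCorrespondenceGLn_of_recGL_eq n K hagree h⟩

/-- **Reciprocity for `𝓡` and direction (A) for `𝓡'` give reciprocity for `𝓡'`** ((A) for both data
forces local agreement, along which (B) transfers). [cite: BuzzardGeeLMS2014, Conj. 3.2.2] -/
theorem globalLanglands_of_automorphicToGalois {𝓡 𝓡' : ReciprocityData K}
    {hcpt : isCompact_glFiniteIntegralLevel n K} (h : GlobalLanglandsCorrespondenceGLn n K 𝓡 hcpt)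
    (hA : AutomorphicToGalois n 𝓡' hcpt) : GlobalLanglandsCorrespondenceGLn n K 𝓡' hcpt :=
  globalLanglandsCorrespondenceGLn_of_recGL_eq n K
    (fun π hπ v πv hπv ↦ recGL_eq_of_automorphicToGalois h.1 hA π hπ v πv hπv) h

end SoloBlind

end Summit.Langlands.Langlands.Theorems

end
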